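import Summits.QuantumFields.BalabanUV.Beta.GAN24.DirichletVertexEndU

/-!
# `BalabanUV.Beta.GAN24.DirichletVertexEndAll` — binder row G-an2-4 / (CONV-C), road P2 PART IV, leaf L14 (the torus transfer), THE END
# AT EVERY LEVEL `N ≥ 1`: the two-level injected law on every union of unit blocks in `d = 2`, rate `C(a′, ε, R)/N`, no threshold on `N`
# (unit b2b-balaban-gan24-p2, gen 27, v1; LOCATED item L27-2 of memo `gen27/L14-END.md`)

HONEST FRAMING (cell contract, verbatim): «discharging `BetaPertH` makes Bałaban's UV stability UNCONDITIONAL — a real constructive-QFT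
result; it is NOT the continuum limit and NOT the Clay problem.»  SUPPLIER module under the T⁴-DAG sub-row `T4-U1a.S-NE2-D1-DIRICHLET°`.

The volume-uniform END `DirichletVertexEndU.injected_rate_union_unif` (p248733) carries the threshold `N ≥ 64` of the dyadic ring
schedule.  Below it the TRIVIAL bound `‖(D′^{Ω′})⁻¹J^Ω − J^Ω(D^Ω)⁻¹‖ ≤ ‖(D′^{Ω′})⁻¹‖‖J^Ω‖ + ‖J^Ω‖‖(D^Ω)⁻¹‖ ≤ 2γ′⁻¹` (coercivity
`DirichletBoxCompression.opNorm_inv_DOm_le`, `‖J₀‖ ≤ 1` `ScalarBlockPlanting.opNorm_JK0_le`, blocks do not increase the norm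
`SubtypeCompression.opNorm_toBlock_le`) already has the rate: `2γ′⁻¹ ≤ 128γ′⁻¹/N` for `N < 64`.  Hence ONE constant
`CendA R ε a′ = CendU R ε a′ + 128·γ′(2, a′)⁻¹` serves every `N ≥ 1`:

  `injected_rate_union_all : ‖(D′^{Ω′})⁻¹J^Ω − J^Ω(D^Ω)⁻¹‖ ≤ CendA R ε a′ / N`   (`Ω = blockReg N M S`, any `S`, `M_ν ≥ 2`, `N ≥ 1`).

§1 is stated for a general dimension `d` and a general region `Ω` (it is the `N`-independent a-priori bound every two-level transfer
starts from); §2 is the `d = 2` assembly.  All declarations are [folklore] finite-dimensional linear algebra; «scoped '85a–'85c +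
King '86 only» — nothing cited beyond the imported modules.
-/

noncomputable section

open scoped BigOperators ComplexConjugate Matrix Matrix.Norms.L2Operator
open Finset

namespace Summit.QuantumFields.BalabanUV.Beta.GAN24.DirichletVertexEndAll

open Literature.MathematicalPhysics.QuantumFieldTheory.Balaban1983to89.B5Prop11Plancherel (Tor fine)
open Summit.QuantumFields.BalabanUV.T4Continuum
open Summit.QuantumFields.BalabanUV.T4Continuum.ScalarAveragedPropagator (gammaPs gammaPs_pos)
open Summit.QuantumFields.BalabanUV.T4Continuum.ScalarBlockPlanting (JK0 opNorm_JK0_le)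
open Summit.QuantumFields.BalabanUV.T4Continuum.SubtypeCompression (opNorm_toBlock_le)
open Summit.QuantumFields.BalabanUV.Beta.GAN24.DirichletBoxTrace (blockReg)
open DirichletBoxCompression (DOm JOm refineR opNorm_inv_DOm_le)
open DirichletVertexDomSumU (alphaDomU)
open DirichletVertexEndU (betaU XfluxU CendU betaU_nonneg alphaDomU_nonneg injected_rate_union_unif)

variable {d : ℕ}

/-! ## §1 The trivial two-level bound (any `d`, any region, any level) -/

/-- `‖J^Ω‖ ≤ 1`: the compressed planting is a block of the isometric planting `J₀`. [folklore] -/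
theorem opNorm_JOm_le (N R : ℕ) [NeZero N] [NeZero R] (M : Fin d → ℕ) [∀ μ, NeZero (M μ)]
    (Ω : Tor (fine N M) → Prop) [DecidablePred Ω] : ‖JOm N R M Ω‖ ≤ 1 :=
  (opNorm_toBlock_le _ _ _).trans (opNorm_JK0_le N R M)

/-- **THE TRIVIAL TWO-LEVEL BOUND** `‖(D′^{Ω′})⁻¹J^Ω − J^Ω(D^Ω)⁻¹‖ ≤ 2γ′⁻¹` at ANY level, from `‖(D^Ω)⁻¹‖ ≤ γ′⁻¹` (coercivity of
`−Δ′ + a′Q′ᵀQ′` restricted to `Ω`) and `‖J^Ω‖ ≤ 1`. [folklore] -/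
theorem two_level_trivial_le (N R : ℕ) [NeZero N] [NeZero R] (M : Fin d → ℕ) [∀ μ, NeZero (M μ)] {a' : ℝ} (ha' : 0 < a')
    (Ω : Tor (fine N M) → Prop) [DecidablePred Ω] :
    ‖(DOm (R * N) M a' (refineR N R M Ω))⁻¹ * JOm N R M Ω - JOm N R M Ω * (DOm N M a' Ω)⁻¹‖ ≤ 2 * (gammaPs d a')⁻¹ := by
  have hJ := opNorm_JOm_le N R M Ω
  have h1 : ‖(DOm (R * N) M a' (refineR N R M Ω))⁻¹ * JOm N R M Ω‖ ≤ (gammaPs d a')⁻¹ * 1 :=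
    (Matrix.l2_opNorm_mul _ _).trans (mul_le_mul (opNorm_inv_DOm_le (R * N) M a' _ ha') hJ (norm_nonneg _)
      (inv_nonneg.mpr (gammaPs_pos (d := d) (a' := a')).1.le))
  have h2 : ‖JOm N R M Ω * (DOm N M a' Ω)⁻¹‖ ≤ 1 * (gammaPs d a')⁻¹ :=
    (Matrix.l2_opNorm_mul _ _).trans (mul_le_mul hJ (opNorm_inv_DOm_le N M a' Ω ha') (norm_nonneg _) zero_le_one)
  calc _ ≤ ‖(DOm (R * N) M a' (refineR N R M Ω))⁻¹ * JOm N R M Ω‖ + ‖JOm N R M Ω * (DOm N M a' Ω)⁻¹‖ := norm_sub_le _ _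
    _ ≤ 2 * (gammaPs d a')⁻¹ := by linarith

/-! ## §2 `d = 2`: one constant for every level `N ≥ 1` -/

/-- `0 ≤ X_U`. [folklore] -/
theorem XfluxU_nonneg (a' : ℝ) {ε : ℝ} (hε : 0 < ε) (hγ : 1 < Real.pi / 3 * (1 - ε / 2)) : 0 ≤ XfluxU ε a' := by
  unfold XfluxU
  have hβ := betaU_nonneg a' hε hγ
  have hα := alphaDomU_nonneg a' (Cg := 1) (gmax := 1) zero_le_one zero_le_one hε hγ
  positivity

/-- `0 ≤ CendU`. [folklore] -/
theorem CendU_nonneg (R : ℕ) (a' : ℝ) {ε : ℝ} (hε : 0 < ε) (hγ : 1 < Real.pi / 3 * (1 - ε / 2)) : 0 ≤ CendU R ε a' := by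
  unfold CendU
  have hX := XfluxU_nonneg a' hε hγ
  positivity

/-- **THE ALL-LEVEL CONSTANT** `C_A(R, ε, a′) = C_U(R, ε, a′) + 128·γ′(2, a′)⁻¹` (the second summand pays for the levels `N < 64`).
[folklore] -/
def CendA (R : ℕ) (ε a' : ℝ) : ℝ := CendU R ε a' + 128 * (gammaPs 2 a')⁻¹

/-- `0 ≤ CendA`. [folklore] -/
theorem CendA_nonneg (R : ℕ) (a' : ℝ) {ε : ℝ} (hε : 0 < ε) (hγ : 1 < Real.pi / 3 * (1 - ε / 2)) : 0 ≤ CendA R ε a' := by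
  unfold CendA
  have h1 := CendU_nonneg R a' hε hγ
  have h2 := (gammaPs_pos (d := 2) (a' := a')).1
  positivity

/-- **THE TWO-LEVEL INJECTED LAW ON EVERY UNION OF UNIT BLOCKS, `d = 2`, AT EVERY LEVEL `N ≥ 1`, VOLUME-FREE**:
`‖(D′^{Ω′})⁻¹J^Ω − J^Ω(D^Ω)⁻¹‖ ≤ C_A(R, ε, a′)/N` for `Ω = ⋃_{b∈S}(b + [0,1)²)` on the torus `(ℤ²/NM)`, any block set `S`, `M_ν ≥ 2`
(`N ≥ 64`: the volume-uniform END p248733; `N < 64`: the trivial bound `2γ′⁻¹ ≤ 128γ′⁻¹/N`). [folklore] -/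
theorem injected_rate_union_all (N R : ℕ) [NeZero N] [NeZero R] (M : Fin 2 → ℕ) [∀ μ, NeZero (M μ)] (S : Tor M → Prop)
    [DecidablePred S] (hM2 : ∀ ν, 2 ≤ M ν) {a' : ℝ} (ha' : 0 < a') {ε : ℝ} (hε : 0 < ε)
    (hγ : 1 < Real.pi / 3 * (1 - ε / 2)) :
    ‖(DOm (R * N) M a' (refineR N R M (blockReg N M S)))⁻¹ * JOm N R M (blockReg N M S)
        - JOm N R M (blockReg N M S) * (DOm N M a' (blockReg N M S))⁻¹‖
      ≤ CendA R ε a' / N := by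
  have hN0 : (0 : ℝ) < N := by exact_mod_cast Nat.pos_of_ne_zero (NeZero.ne N)
  have hγp := (gammaPs_pos (d := 2) (a' := a')).1
  have hCU := CendU_nonneg R a' hε hγ
  by_cases hN : 64 ≤ N
  · refine (injected_rate_union_unif N R M S hN hM2 ha' hε hγ).trans ?_
    unfold CendA
    gcongr
    have : 0 ≤ 128 * (gammaPs 2 a')⁻¹ := by positivity
    linarith
  · have hN64 : (N : ℝ) ≤ 64 := by exact_mod_cast (Nat.lt_of_not_le hN).le
    refine (two_level_trivial_le N R M ha' (blockReg N M S)).trans ?_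
    rw [le_div_iff₀ hN0, CendA]
    have hγi : 0 ≤ (gammaPs 2 a')⁻¹ := inv_nonneg.mpr hγp.le
    nlinarith

end Summit.QuantumFields.BalabanUV.Beta.GAN24.DirichletVertexEndAll

end
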